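import Literature.Analysis.FluidPDE.LocalPressureOscillation
import Literature.Analysis.FluidPDE.SpaceTimeRescaling
import HarnessLib

/-!
# The local pressure oscillation estimate on one slice: all scales (Robinson–Rodrigo–Sadowski, Lemma 15.12)

Analysis/FluidPDE file (all results proved, no definitions, no named facts) in the discharge of
the named fact `Literature.Analysis.FluidPDE.RRS2016.lemma15_12` (`CKNLocalRegularityRRS.lean`;
Robinson–Rodrigo–Sadowski 2016, **Lemma 15.12**, pp. 232–234, slice-wise form of p. 234). The
accepted `LocalPressureOscillation.lean` proves the one-slice estimate at unit scale `ρ = 1`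
(`setLIntegral_pressure_oscillation_le_unitScale`); this file removes the normalisation:

* `setLIntegral_pressure_oscillation_le` — for `p ∈ L^{3/2}(B_ρ(a))`, `u ∈ L³(B_ρ(a))` with
  `∫ p Δφ = -∫ D²φ(u,u)` for all test functions supported in `B_ρ(a)` and `0 < r ≤ ρ/2`,
  `∫_{B_r} |p - (p)_r|^{3/2} ≤ C [∫_{B_{2r}} |u|³ + r^{9/2} (∫_{2r<|y-a|<ρ} |u|²|y-a|⁻⁴)^{3/2}
    + (r/ρ)^{9/2} ∫_{B_ρ} (|u|³ + |p|^{3/2})]` with an absolute `C`.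

The reduction is the dilation `A y = a + ρ y`: `p'(y) = ρ² p(A y)`, `u'(y) = ρ u(A y)` satisfy the
pressure equation on `B_1(0)` (a test function `φ` on `B_1(0)` is pulled back to
`φ(ρ⁻¹(x - a))` on `B_ρ(a)`; `Δ` and `D²` scale by `ρ⁻²`, `dx = ρ³ dy`), and every term of the
inequality is invariant (`(p')_{r/ρ} = ρ² (p)_r`, `|B_{r/ρ}| = ρ⁻³|B_r|`, the shell weight
`|y|⁻⁴` scales by `ρ⁴`). The space-dilation tools (`map_space_affine_volume_restrict_preimage`,
`AEStronglyMeasurable.comp_space_affine`, `setIntegral_preimage_comp_space_affine`,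
`fderiv_fderiv_comp_space_affine_apply`, `laplacian_comp_space_affine`) complement the accepted
`SpaceTimeRescaling.lean` (`integral_comp_space_affine`, `setLIntegral_preimage_comp_space_affine`,
`space_affine_preimage_ball`, `fderiv_stPull`, `laplacian_stPull`).

## References

* J. C. Robinson, J. L. Rodrigo, W. Sadowski, *The three-dimensional Navier–Stokes equations*,
  CUP (2016): Lemma 15.12, pp. 232–234 (and the dimensionless form at the end of its proof,
  p. 234). [RobinsonRodrigoSadowski2016]
-/

noncomputable section

open MeasureTheory Set Function Filter Topology TopologicalSpace Metric
open scoped ENNReal NNReal RealInnerProductSpace ContDiff Laplacian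

namespace Literature.Analysis.FluidPDE

-- nested operator types `ℝ³ →L[ℝ] ℝ³ →L[ℝ] ℝ`
set_option maxSynthPendingDepth 3

/-! ### The space dilation `y ↦ x₀ + γ y`: measures, measurability, integrals, derivatives -/

section SpaceAffine

variable {E : Type*} [NormedAddCommGroup E] [InnerProductSpace ℝ E] [FiniteDimensional ℝ E]
  [MeasurableSpace E] [BorelSpace E]

/-- Push-forward of Lebesgue measure restricted to a preimage: for `A y = x₀ + γ y`, `γ > 0`,
`A_*(vol|_{A⁻¹S}) = (γⁿ)⁻¹ vol|_S`. [folklore] -/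
theorem map_space_affine_volume_restrict_preimage {γ : ℝ} (hγ : 0 < γ) (x₀ : E) (S : Set E) :
    Measure.map (fun y : E => x₀ + γ • y) (volume.restrict ((fun y : E => x₀ + γ • y) ⁻¹' S)) =
      ENNReal.ofReal (γ ^ Module.finrank ℝ E)⁻¹ • volume.restrict S := by
  have hme := (spaceAffineHomeomorph hγ.ne' x₀).measurableEmbedding
  have h1 := hme.restrict_map (volume : Measure E) S
  rw [coe_spaceAffineHomeomorph] at h1
  rw [← h1, map_space_affine_volume hγ, Measure.restrict_smul]

/-- A.e.-strong measurability is preserved by the dilation: if `f` is a.e.-strongly measurable on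
`S` then `f ∘ A` is a.e.-strongly measurable on `A⁻¹ S`. [folklore] -/
theorem _root_.MeasureTheory.AEStronglyMeasurable.comp_space_affine {F : Type*} [TopologicalSpace F]
    {f : E → F} {S : Set E} (hf : AEStronglyMeasurable f (volume.restrict S)) {γ : ℝ} (hγ : 0 < γ)
    (x₀ : E) :
    AEStronglyMeasurable (fun y => f (x₀ + γ • y))
      (volume.restrict ((fun y : E => x₀ + γ • y) ⁻¹' S)) := by
  have h1 : AEStronglyMeasurable f
      (Measure.map (fun y : E => x₀ + γ • y) (volume.restrict ((fun y : E => x₀ + γ • y) ⁻¹' S))) := by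
    rw [map_space_affine_volume_restrict_preimage hγ]
    exact hf.smul_measure _
  exact h1.comp_measurable ((measurable_const_add x₀).comp (measurable_const_smul γ))

/-- Space change of variables (Bochner, over a set): `∫_{A⁻¹ S} F(x₀ + γ y) dy = (γⁿ)⁻¹ ∫_S F`.
[folklore] -/
theorem setIntegral_preimage_comp_space_affine {G : Type*} [NormedAddCommGroup G] [NormedSpace ℝ G]
    {γ : ℝ} (hγ : 0 < γ) (x₀ : E) (F : E → G) (S : Set E) :
    ∫ y in (fun y : E => x₀ + γ • y) ⁻¹' S, F (x₀ + γ • y) =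
      (γ ^ Module.finrank ℝ E)⁻¹ • ∫ x in S, F x := by
  have hme := (spaceAffineHomeomorph hγ.ne' x₀).measurableEmbedding
  have := hme.setIntegral_map (μ := (volume : Measure E)) F S
  rw [coe_spaceAffineHomeomorph] at this
  rw [← this, map_space_affine_volume hγ, Measure.restrict_smul, integral_smul_measure,
    ENNReal.toReal_ofReal (by positivity)]

omit [FiniteDimensional ℝ E] [MeasurableSpace E] [BorelSpace E] in
/-- Second derivatives under the dilation: `D²(φ ∘ A)(y)(v, w) = γ² D²φ(A y)(v, w)` for `φ ∈ C²`.
[folklore] -/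
theorem fderiv_fderiv_comp_space_affine_apply {φ : E → ℝ} (hφ : ContDiff ℝ 2 φ) {γ : ℝ} (x₀ : E)
    (y v w : E) :
    fderiv ℝ (fderiv ℝ (fun y : E => φ (x₀ + γ • y))) y v w =
      γ ^ 2 * fderiv ℝ (fderiv ℝ φ) (x₀ + γ • y) v w := by
  have h1 : fderiv ℝ (fun y : E => φ (x₀ + γ • y)) = fun y => γ • fderiv ℝ φ (x₀ + γ • y) :=
    funext fun y => fderiv_stPull 1 γ 0 x₀ (fun _ => φ) 0 y
  have hd : Differentiable ℝ (fun y : E => fderiv ℝ φ (x₀ + γ • y)) :=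
    ((hφ.fderiv_right (m := 1) le_rfl).differentiable one_ne_zero).comp
      ((differentiable_const _).add (differentiable_id.const_smul _))
  rw [h1, fderiv_fun_const_smul (hd y)]
  have h2 : fderiv ℝ (fun y : E => fderiv ℝ φ (x₀ + γ • y)) y =
      γ • fderiv ℝ (fderiv ℝ φ) (x₀ + γ • y) :=
    fderiv_stPull 1 γ 0 x₀ (fun _ => fderiv ℝ φ) 0 y
  rw [h2]
  simp only [FunLike.coe_smul, Pi.smul_apply, smul_eq_mul]
  ring

omit [MeasurableSpace E] [BorelSpace E] in
/-- The Laplacian under the dilation: `Δ(φ ∘ A)(y) = γ² (Δφ)(A y)` for `φ ∈ C²`. [folklore] -/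
theorem laplacian_comp_space_affine {φ : E → ℝ} (hφ : ContDiff ℝ 2 φ) (γ : ℝ) (x₀ y : E) :
    Δ (fun y : E => φ (x₀ + γ • y)) y = γ ^ 2 * (Δ φ) (x₀ + γ • y) := by
  have h := laplacian_stPull 1 γ 0 x₀ (fun _ => φ) 0 y hφ
  rw [smul_eq_mul] at h
  exact h

end SpaceAffine

/-! ### Lemma 15.12 on one slice, all scales -/

/-- `‖ρ • v‖ₑ² / ((d₀/ρ)⁴) = ρ⁶ (‖v‖ₑ² / d₀⁴)` in `ℝ≥0∞` for `ρ, d₀ > 0` (the weight of the middle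
term of Lemma 15.12 under the dilation). [folklore] -/
theorem enorm_smul_sq_div_eq {ρ d₀ : ℝ} (hρ : 0 < ρ) (hd : 0 < d₀) (v : EuclideanSpace ℝ (Fin 3)) :
    ‖ρ • v‖ₑ ^ 2 / ENNReal.ofReal ((d₀ / ρ) ^ 4) =
      ENNReal.ofReal (ρ ^ 6) * (‖v‖ₑ ^ 2 / ENNReal.ofReal (d₀ ^ 4)) := by
  have h1 : ‖ρ • v‖ₑ ^ 2 = ENNReal.ofReal (ρ ^ 2) * ‖v‖ₑ ^ 2 := by
    rw [enorm_smul, mul_pow, Real.enorm_eq_ofReal hρ.le, ENNReal.ofReal_pow hρ.le]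
  rw [h1, ENNReal.div_eq_inv_mul, ENNReal.div_eq_inv_mul, ← ENNReal.ofReal_inv_of_pos (by positivity),
    ← ENNReal.ofReal_inv_of_pos (by positivity), ← mul_assoc, ← mul_assoc,
    ← ENNReal.ofReal_mul (by positivity), ← ENNReal.ofReal_mul (by positivity)]
  congr 1
  field_simp

/-- **The local pressure oscillation estimate on one slice, all scales** (Robinson–Rodrigo–
Sadowski 2016, Lemma 15.12 in the slice-wise form of p. 234). There is an absolute constant `C`
such that: if `p ∈ L^{3/2}(B_ρ(a))`, `u ∈ L³(B_ρ(a))` (a.e.-strongly measurable on the ball,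
`ρ > 0`) satisfy `∫ p Δφ = -∫ D²φ(u, u)` for every test function `φ` supported in `B_ρ(a)` (the
pressure equation `-Δp = ∂ᵢ∂ⱼ(uᵢuⱼ)` in `𝒟'(B_ρ(a))`), then for `0 < r ≤ ρ/2`
`∫_{B_r} |p - (p)_r|^{3/2} ≤ C [∫_{B_{2r}} |u|³ + r^{9/2} (∫_{2r<|y-a|<ρ} |u|²|y-a|⁻⁴)^{3/2}
  + (r/ρ)^{9/2} ∫_{B_ρ} (|u|³ + |p|^{3/2})]`.
Reduction to `ρ = 1` (`setLIntegral_pressure_oscillation_le_unitScale`) by the dilation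
`p'(y) = ρ² p(a + ρy)`, `u'(y) = ρ u(a + ρy)`, `r' = r/ρ`, under which the pressure equation is
invariant and every term of the inequality is dimensionless. [cite: RobinsonRodrigoSadowski2016, Lemma 15.12 pp. 232–234] -/
theorem setLIntegral_pressure_oscillation_le :
    ∃ C : ℝ≥0, ∀ (a : EuclideanSpace ℝ (Fin 3)) (ρ r : ℝ) (p : EuclideanSpace ℝ (Fin 3) → ℝ)
      (u : EuclideanSpace ℝ (Fin 3) → EuclideanSpace ℝ (Fin 3)), 0 < ρ → 0 < r → r ≤ ρ / 2 →
      AEStronglyMeasurable p (volume.restrict (ball a ρ)) →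
      AEStronglyMeasurable u (volume.restrict (ball a ρ)) →
      ∫⁻ x in ball a ρ, ‖p x‖ₑ ^ (3 / 2 : ℝ) < ⊤ →
      ∫⁻ x in ball a ρ, ‖u x‖ₑ ^ (3 : ℕ) < ⊤ →
      (∀ φ : EuclideanSpace ℝ (Fin 3) → ℝ, ContDiff ℝ (⊤ : ℕ∞) φ → HasCompactSupport φ →
        tsupport φ ⊆ ball a ρ →
        ∫ x, p x * (Δ φ) x = -∫ x, fderiv ℝ (fderiv ℝ φ) x (u x) (u x)) →
      ∫⁻ x in ball a r, ‖p x - ⨍ y in ball a r, p y‖ₑ ^ (3 / 2 : ℝ) ≤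
        C * ((∫⁻ x in ball a (2 * r), ‖u x‖ₑ ^ (3 : ℕ)) +
          ENNReal.ofReal (r ^ (9 / 2 : ℝ)) *
            (∫⁻ y in {y | 2 * r < dist y a ∧ dist y a < ρ},
              ‖u y‖ₑ ^ 2 / ENNReal.ofReal (dist y a ^ 4)) ^ (3 / 2 : ℝ) +
          ENNReal.ofReal (r ^ (9 / 2 : ℝ) / ρ ^ (9 / 2 : ℝ)) *
            ∫⁻ x in ball a ρ, (‖u x‖ₑ ^ (3 : ℕ) + ‖p x‖ₑ ^ (3 / 2 : ℝ))) := by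
  obtain ⟨C, hC⟩ := setLIntegral_pressure_oscillation_le_unitScale
  refine ⟨C, fun a ρ r p u hρ hr hrρ hpm hum hp hu hid => ?_⟩
  -- the dilation and the rescaled pair
  set A : EuclideanSpace ℝ (Fin 3) → EuclideanSpace ℝ (Fin 3) := fun y => a + ρ • y with hA
  set p' : EuclideanSpace ℝ (Fin 3) → ℝ := fun y => ρ ^ 2 * p (A y) with hp'
  set u' : EuclideanSpace ℝ (Fin 3) → EuclideanSpace ℝ (Fin 3) := fun y => ρ • u (A y) with hu'
  set r' : ℝ := r / ρ with hr'
  have hr'0 : 0 < r' := div_pos hr hρ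
  have hr'2 : r' ≤ 1 / 2 := by rw [hr', div_le_iff₀ hρ]; linarith
  have hρ3 : 0 < ρ ^ 3 := pow_pos hρ 3
  have eρ3 : ENNReal.ofReal (ρ ^ 3) ≠ 0 := (ENNReal.ofReal_pos.2 hρ3).ne'
  have eρ3t : ENNReal.ofReal (ρ ^ 3) ≠ ⊤ := ENNReal.ofReal_ne_top
  have hAapply : ∀ y, A y = a + ρ • y := fun y => rfl
  have hdistA : ∀ y, dist (A y) a = ρ * dist y 0 := fun y => by
    rw [hAapply, dist_eq_norm, dist_zero_right, add_sub_cancel_left, norm_smul, Real.norm_of_nonneg hρ.le]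
  -- preimages of balls and of the shell
  have hpre : ∀ R : ℝ, A ⁻¹' ball a R = ball 0 (R / ρ) := fun R => by
    rw [hA, space_affine_preimage_ball hρ a a R, sub_self, smul_zero]
  have hpre1 : A ⁻¹' ball a ρ = ball 0 1 := by rw [hpre, div_self hρ.ne']
  have hpre_r : A ⁻¹' ball a r = ball 0 r' := hpre r
  have hpre_2r : A ⁻¹' ball a (2 * r) = ball 0 (2 * r') := by rw [hpre, hr', mul_div_assoc]
  set S : Set (EuclideanSpace ℝ (Fin 3)) := {y | 2 * r < dist y a ∧ dist y a < ρ} with hS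
  set S' : Set (EuclideanSpace ℝ (Fin 3)) := {y | 2 * r' < dist y 0 ∧ dist y 0 < 1} with hS'
  have hpreS : A ⁻¹' S = S' := by
    ext y
    simp only [hS, hS', mem_preimage, mem_setOf_eq, hdistA]
    rw [hr', show 2 * (r / ρ) = (2 * r) / ρ by ring, div_lt_iff₀ hρ, mul_comm (dist y 0) ρ]
    constructor
    · rintro ⟨h1, h2⟩
      exact ⟨by linarith, by nlinarith⟩
    · rintro ⟨h1, h2⟩
      exact ⟨by linarith, by nlinarith⟩
  -- the change of variables in lower integrals
  have hcv : ∀ (F : EuclideanSpace ℝ (Fin 3) → ℝ≥0∞) (T : Set (EuclideanSpace ℝ (Fin 3))),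
      ∫⁻ y in A ⁻¹' T, F (A y) = (ENNReal.ofReal (ρ ^ 3))⁻¹ * ∫⁻ x in T, F x := by
    intro F T
    have h := setLIntegral_preimage_comp_space_affine hρ a F T
    rw [finrank_euclideanSpace_fin, ENNReal.ofReal_inv_of_pos hρ3] at h
    exact h
  -- ### the hypotheses of the unit-scale statement
  have hp'm : AEStronglyMeasurable p' (volume.restrict (ball 0 1)) := by
    have h := hpm.comp_space_affine hρ a
    rw [hpre1] at h
    exact h.const_mul _
  have hu'm : AEStronglyMeasurable u' (volume.restrict (ball 0 1)) := by
    have h := hum.comp_space_affine hρ a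
    rw [hpre1] at h
    exact h.const_smul ρ
  have hp'fin : ∫⁻ y in ball 0 1, ‖p' y‖ₑ ^ (3 / 2 : ℝ) < ⊤ := by
    have e : ∀ y, ‖p' y‖ₑ ^ (3 / 2 : ℝ) = ENNReal.ofReal (ρ ^ 2) ^ (3 / 2 : ℝ) * ‖p (A y)‖ₑ ^ (3 / 2 : ℝ) := by
      intro y
      rw [hp']
      simp only
      rw [enorm_mul, ENNReal.mul_rpow_of_nonneg _ _ (by norm_num), Real.enorm_eq_ofReal (by positivity)]
    simp_rw [e]
    rw [← hpre1, hcv (fun x => ENNReal.ofReal (ρ ^ 2) ^ (3 / 2 : ℝ) * ‖p x‖ₑ ^ (3 / 2 : ℝ)) (ball a ρ),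
      lintegral_const_mul' _ _ (ENNReal.rpow_ne_top_of_nonneg (by norm_num) ENNReal.ofReal_ne_top)]
    exact ENNReal.mul_lt_top (ENNReal.inv_lt_top.2 (ENNReal.ofReal_pos.2 hρ3))
      (ENNReal.mul_lt_top (ENNReal.rpow_lt_top_of_nonneg (by norm_num) ENNReal.ofReal_ne_top) hp)
  have hu'fin : ∫⁻ y in ball 0 1, ‖u' y‖ₑ ^ (3 : ℕ) < ⊤ := by
    have e : ∀ y, ‖u' y‖ₑ ^ (3 : ℕ) = ENNReal.ofReal ρ ^ (3 : ℕ) * ‖u (A y)‖ₑ ^ (3 : ℕ) := by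
      intro y
      rw [hu']
      simp only
      rw [enorm_smul, mul_pow, Real.enorm_eq_ofReal hρ.le]
    simp_rw [e]
    rw [← hpre1, hcv (fun x => ENNReal.ofReal ρ ^ (3 : ℕ) * ‖u x‖ₑ ^ (3 : ℕ)) (ball a ρ),
      lintegral_const_mul' _ _ (ENNReal.pow_ne_top ENNReal.ofReal_ne_top)]
    exact ENNReal.mul_lt_top (ENNReal.inv_lt_top.2 (ENNReal.ofReal_pos.2 hρ3))
      (ENNReal.mul_lt_top (ENNReal.pow_lt_top ENNReal.ofReal_lt_top) hu)
  -- the pressure equation is invariant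
  have hid' : ∀ φ : EuclideanSpace ℝ (Fin 3) → ℝ, ContDiff ℝ (⊤ : ℕ∞) φ → HasCompactSupport φ →
      tsupport φ ⊆ ball 0 1 →
      ∫ y, p' y * (Δ φ) y = -∫ y, fderiv ℝ (fderiv ℝ φ) y (u' y) (u' y) := by
    intro φ hφ hφc hφs
    -- the pulled-back test function `φ̃(x) = φ(ρ⁻¹(x - a))`
    set x₁ : EuclideanSpace ℝ (Fin 3) := -(ρ⁻¹ • a) with hx₁
    set φ' : EuclideanSpace ℝ (Fin 3) → ℝ := fun x => φ (x₁ + ρ⁻¹ • x) with hφ'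
    have hρi : 0 < ρ⁻¹ := inv_pos.2 hρ
    have hinv : ∀ y, x₁ + ρ⁻¹ • A y = y := fun y => by
      rw [hAapply, hx₁, smul_add, smul_smul, inv_mul_cancel₀ hρ.ne', one_smul]
      abel
    have hφ's : ContDiff ℝ (⊤ : ℕ∞) φ' :=
      hφ.comp (contDiff_const.add (contDiff_const_smul _))
    have hφ'c : HasCompactSupport φ' :=
      hφc.comp_homeomorph (spaceAffineHomeomorph hρi.ne' x₁)
    have hφ'supp : tsupport φ' ⊆ ball a ρ := by
      have h1 : tsupport φ' ⊆ (fun x => x₁ + ρ⁻¹ • x) ⁻¹' tsupport φ := by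
        rw [hφ', tsupport, show (fun x => φ (x₁ + ρ⁻¹ • x)) = φ ∘ fun x => x₁ + ρ⁻¹ • x from rfl,
          Function.support_comp_eq_preimage]
        exact (by fun_prop : Continuous fun x : EuclideanSpace ℝ (Fin 3) => x₁ + ρ⁻¹ • x).closure_preimage_subset _
      refine h1.trans ?_
      intro x hx
      have hx' : x₁ + ρ⁻¹ • x ∈ ball (0 : EuclideanSpace ℝ (Fin 3)) 1 := hφs hx
      rw [mem_ball, dist_zero_right] at hx'
      rw [mem_ball, dist_eq_norm]
      have e : x₁ + ρ⁻¹ • x = ρ⁻¹ • (x - a) := by rw [hx₁, smul_sub]; abel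
      rw [e, norm_smul, Real.norm_of_nonneg hρi.le] at hx'
      rwa [inv_mul_lt_iff₀ hρ, mul_one] at hx'
    have hφ2 : ContDiff ℝ 2 φ := contDiff_infty.1 hφ 2
    have hφ'2 : ContDiff ℝ 2 φ' := contDiff_infty.1 hφ's 2
    -- the pressure equation for `φ'`
    have key := hid φ' hφ's hφ'c hφ'supp
    -- the chain rules at the points `A y`
    have hΔ : ∀ y, Δ φ y = ρ ^ 2 * Δ φ' (A y) := by
      intro y
      have h := laplacian_comp_space_affine hφ2 ρ⁻¹ x₁ (A y)
      rw [hinv] at h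
      change Δ φ' (A y) = (ρ⁻¹) ^ 2 * Δ φ y at h
      rw [h, ← mul_assoc, ← mul_pow, mul_inv_cancel₀ hρ.ne', one_pow, one_mul]
    have hD : ∀ y v w, fderiv ℝ (fderiv ℝ φ) y v w = ρ ^ 2 * fderiv ℝ (fderiv ℝ φ') (A y) v w := by
      intro y v w
      have h := fderiv_fderiv_comp_space_affine_apply hφ2 x₁ (A y) v w (γ := ρ⁻¹)
      rw [hinv] at h
      change fderiv ℝ (fderiv ℝ φ') (A y) v w = (ρ⁻¹) ^ 2 * fderiv ℝ (fderiv ℝ φ) y v w at h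
      rw [h, ← mul_assoc, ← mul_pow, mul_inv_cancel₀ hρ.ne', one_pow, one_mul]
    -- change variables in both sides
    have hL : ∫ y, p' y * Δ φ y = ρ * ∫ x, p x * Δ φ' x := by
      have h := integral_comp_space_affine hρ a (fun x => (ρ ^ 4 * p x) * Δ φ' x)
      rw [finrank_euclideanSpace_fin] at h
      have e : ∀ y, p' y * Δ φ y = (ρ ^ 4 * p (A y)) * Δ φ' (A y) := by
        intro y
        rw [hΔ y, hp']
        ring
      simp_rw [e]
      change ∫ y, (ρ ^ 4 * p (a + ρ • y)) * Δ φ' (a + ρ • y) = _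
      rw [h, smul_eq_mul]
      have e2 : ∫ x, ρ ^ 4 * p x * Δ φ' x = ρ ^ 4 * ∫ x, p x * Δ φ' x := by
        rw [← integral_const_mul]
        refine integral_congr_ae (Eventually.of_forall fun x => ?_)
        ring
      rw [e2]
      field_simp
    have hR : ∫ y, fderiv ℝ (fderiv ℝ φ) y (u' y) (u' y) =
        ρ * ∫ x, fderiv ℝ (fderiv ℝ φ') x (u x) (u x) := by
      have h := integral_comp_space_affine hρ a
        (fun x => ρ ^ 4 * fderiv ℝ (fderiv ℝ φ') x (u x) (u x))
      rw [finrank_euclideanSpace_fin] at h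
      have e : ∀ y, fderiv ℝ (fderiv ℝ φ) y (u' y) (u' y) =
          ρ ^ 4 * fderiv ℝ (fderiv ℝ φ') (A y) (u (A y)) (u (A y)) := by
        intro y
        rw [hD y, hu']
        simp only [map_smul, FunLike.coe_smul, Pi.smul_apply, smul_eq_mul]
        ring
      simp_rw [e]
      change ∫ y, ρ ^ 4 * fderiv ℝ (fderiv ℝ φ') (a + ρ • y) (u (a + ρ • y)) (u (a + ρ • y)) = _
      rw [h, smul_eq_mul, integral_const_mul]
      field_simp
    rw [hL, hR, key]
    ring
  -- ### the unit-scale estimate for the rescaled pair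
  have hunit := hC 0 r' p' u' hr'0 hr'2 hp'm hu'm hp'fin hu'fin hid'
  -- ### conversion of every term back to the original scale
  have hρ23 : ENNReal.ofReal (ρ ^ 2) ^ (3 / 2 : ℝ) = ENNReal.ofReal (ρ ^ 3) := by
    rw [ENNReal.ofReal_rpow_of_nonneg (by positivity) (by norm_num), ← Real.rpow_natCast,
      ← Real.rpow_mul hρ.le, ← Real.rpow_natCast]
    norm_num
  have hcancel : (ENNReal.ofReal (ρ ^ 3))⁻¹ * ENNReal.ofReal (ρ ^ 3) = 1 := ENNReal.inv_mul_cancel eρ3 eρ3t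
  -- (L) the left-hand side
  set m : ℝ := ⨍ y in ball a r, p y with hm
  have hVr : volume (ball a r) = ENNReal.ofReal (r ^ 3) * volume (ball (0 : EuclideanSpace ℝ (Fin 3)) 1) :=
    volume_ball_eq_ofReal_mul a hr.le
  have hVr' : volume (ball (0 : EuclideanSpace ℝ (Fin 3)) r') =
      (ENNReal.ofReal (ρ ^ 3))⁻¹ * volume (ball a r) := by
    rw [volume_ball_eq_ofReal_mul 0 hr'0.le, hVr, ← mul_assoc, ← ENNReal.ofReal_inv_of_pos hρ3,
      ← ENNReal.ofReal_mul (by positivity), hr', div_pow]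
    congr 2
    field_simp
  have hV0 : 0 < volume.real (ball a r) := by
    rw [measureReal_def]
    exact ENNReal.toReal_pos (measure_ball_pos volume a hr).ne' measure_ball_lt_top.ne
  have havg : ⨍ y in ball (0 : EuclideanSpace ℝ (Fin 3)) r', p' y = ρ ^ 2 * m := by
    rw [hm, setAverage_eq, setAverage_eq, smul_eq_mul, smul_eq_mul]
    have h1 : ∫ y in ball (0 : EuclideanSpace ℝ (Fin 3)) r', p' y = (ρ ^ 3)⁻¹ * ∫ x in ball a r, ρ ^ 2 * p x := by
      have h := setIntegral_preimage_comp_space_affine hρ a (fun x => ρ ^ 2 * p x) (ball a r)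
      rw [finrank_euclideanSpace_fin, smul_eq_mul] at h
      rw [← hpre_r]
      exact h
    have h2 : volume.real (ball (0 : EuclideanSpace ℝ (Fin 3)) r') = (ρ ^ 3)⁻¹ * volume.real (ball a r) := by
      rw [measureReal_def, measureReal_def, hVr', ENNReal.toReal_mul, ENNReal.toReal_inv,
        ENNReal.toReal_ofReal hρ3.le]
    rw [h1, integral_const_mul, h2]
    field_simp
  have hLHS : ∫⁻ x in ball (0 : EuclideanSpace ℝ (Fin 3)) r', ‖p' x - ⨍ y in ball (0 : EuclideanSpace ℝ (Fin 3)) r', p' y‖ₑ ^ (3 / 2 : ℝ) =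
      ∫⁻ x in ball a r, ‖p x - m‖ₑ ^ (3 / 2 : ℝ) := by
    rw [havg]
    have e : ∀ y, ‖p' y - ρ ^ 2 * m‖ₑ ^ (3 / 2 : ℝ) = ENNReal.ofReal (ρ ^ 3) * ‖p (A y) - m‖ₑ ^ (3 / 2 : ℝ) := by
      intro y
      rw [hp']
      simp only
      rw [← mul_sub, enorm_mul, ENNReal.mul_rpow_of_nonneg _ _ (by norm_num),
        Real.enorm_eq_ofReal (by positivity), hρ23]
    simp_rw [e]
    rw [← hpre_r, hcv (fun x => ENNReal.ofReal (ρ ^ 3) * ‖p x - m‖ₑ ^ (3 / 2 : ℝ)) (ball a r),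
      lintegral_const_mul' _ _ eρ3t, ← mul_assoc, hcancel, one_mul]
  -- (X₁) the near term
  have hX₁ : ∫⁻ x in ball (0 : EuclideanSpace ℝ (Fin 3)) (2 * r'), ‖u' x‖ₑ ^ (3 : ℕ) =
      ∫⁻ x in ball a (2 * r), ‖u x‖ₑ ^ (3 : ℕ) := by
    have e : ∀ y, ‖u' y‖ₑ ^ (3 : ℕ) = ENNReal.ofReal (ρ ^ 3) * ‖u (A y)‖ₑ ^ (3 : ℕ) := by
      intro y
      rw [hu']
      simp only
      rw [enorm_smul, mul_pow, Real.enorm_eq_ofReal hρ.le, ENNReal.ofReal_pow hρ.le]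
    simp_rw [e]
    rw [← hpre_2r, hcv (fun x => ENNReal.ofReal (ρ ^ 3) * ‖u x‖ₑ ^ (3 : ℕ)) (ball a (2 * r)),
      lintegral_const_mul' _ _ eρ3t, ← mul_assoc, hcancel, one_mul]
  -- (X₂) the shell term
  have hS'm : MeasurableSet S' := by
    rw [hS']
    exact ((isOpen_lt continuous_const (continuous_id.dist continuous_const)).inter
      (isOpen_lt (continuous_id.dist continuous_const) continuous_const)).measurableSet
  have hX₂ : ∫⁻ y in S', ‖u' y‖ₑ ^ 2 / ENNReal.ofReal (dist y 0 ^ 4) =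
      ENNReal.ofReal (ρ ^ 3) * ∫⁻ y in S, ‖u y‖ₑ ^ 2 / ENNReal.ofReal (dist y a ^ 4) := by
    have e : ∀ y ∈ S', ‖u' y‖ₑ ^ 2 / ENNReal.ofReal (dist y 0 ^ 4) =
        ENNReal.ofReal (ρ ^ 6) * (‖u (A y)‖ₑ ^ 2 / ENNReal.ofReal (dist (A y) a ^ 4)) := by
      intro y hy
      have hd0 : 0 < dist (A y) a := by
        rw [hdistA]
        have : 2 * r' < dist y 0 := hy.1
        nlinarith
      have hdy : dist y 0 = dist (A y) a / ρ := by
        rw [hdistA]; field_simp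
      rw [hu']
      simp only
      rw [hdy, enorm_smul_sq_div_eq hρ hd0]
    rw [setLIntegral_congr_fun hS'm e, ← hpreS,
      hcv (fun x => ENNReal.ofReal (ρ ^ 6) * (‖u x‖ₑ ^ 2 / ENNReal.ofReal (dist x a ^ 4))) S,
      lintegral_const_mul' _ _ ENNReal.ofReal_ne_top, ← mul_assoc]
    congr 1
    rw [show ρ ^ 6 = ρ ^ 3 * ρ ^ 3 by ring, ENNReal.ofReal_mul hρ3.le, ← mul_assoc, hcancel, one_mul]
  have hX₂' : ENNReal.ofReal (r' ^ (9 / 2 : ℝ)) *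
      (∫⁻ y in S', ‖u' y‖ₑ ^ 2 / ENNReal.ofReal (dist y 0 ^ 4)) ^ (3 / 2 : ℝ) =
      ENNReal.ofReal (r ^ (9 / 2 : ℝ)) *
        (∫⁻ y in S, ‖u y‖ₑ ^ 2 / ENNReal.ofReal (dist y a ^ 4)) ^ (3 / 2 : ℝ) := by
    rw [hX₂, ENNReal.mul_rpow_of_nonneg _ _ (by norm_num), ← mul_assoc,
      ENNReal.ofReal_rpow_of_nonneg hρ3.le (by norm_num), ← ENNReal.ofReal_mul (by positivity)]
    congr 2
    rw [hr', Real.div_rpow hr.le hρ.le, ← Real.rpow_natCast, ← Real.rpow_mul hρ.le]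
    norm_num
    field_simp
  -- (X₃) the full-ball term
  have hX₃ : ∫⁻ x in ball (0 : EuclideanSpace ℝ (Fin 3)) 1, (‖u' x‖ₑ ^ (3 : ℕ) + ‖p' x‖ₑ ^ (3 / 2 : ℝ)) =
      ∫⁻ x in ball a ρ, (‖u x‖ₑ ^ (3 : ℕ) + ‖p x‖ₑ ^ (3 / 2 : ℝ)) := by
    have e : ∀ y, ‖u' y‖ₑ ^ (3 : ℕ) + ‖p' y‖ₑ ^ (3 / 2 : ℝ) =
        ENNReal.ofReal (ρ ^ 3) * (‖u (A y)‖ₑ ^ (3 : ℕ) + ‖p (A y)‖ₑ ^ (3 / 2 : ℝ)) := by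
      intro y
      rw [hu', hp']
      simp only
      rw [enorm_smul, mul_pow, Real.enorm_eq_ofReal hρ.le, ← ENNReal.ofReal_pow hρ.le, enorm_mul,
        ENNReal.mul_rpow_of_nonneg _ _ (by norm_num), Real.enorm_eq_ofReal (by positivity), hρ23,
        mul_add]
    simp_rw [e]
    rw [← hpre1, hcv (fun x => ENNReal.ofReal (ρ ^ 3) * (‖u x‖ₑ ^ (3 : ℕ) + ‖p x‖ₑ ^ (3 / 2 : ℝ)))
      (ball a ρ), lintegral_const_mul' _ _ eρ3t, ← mul_assoc, hcancel, one_mul]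
  have hr92 : ENNReal.ofReal (r' ^ (9 / 2 : ℝ)) = ENNReal.ofReal (r ^ (9 / 2 : ℝ) / ρ ^ (9 / 2 : ℝ)) := by
    rw [hr', Real.div_rpow hr.le hρ.le]
  -- ### conclusion
  rw [← hLHS, ← hX₁, ← hX₂', ← hX₃, ← hr92]
  exact hunit

end Literature.Analysis.FluidPDE

end
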